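import Literature.NumberTheory.GaloisCohomology.Howard2004.UnramifiedSelfOrthogonalReadout
import Literature.NumberTheory.GaloisRepresentations.LocalDualityTwoZeroSeparation
import Literature.NumberTheory.GaloisRepresentations.LocalGlobalCohomologyTateProofs
import Literature.NumberTheory.GaloisRepresentations.LocalGlobalCohomologyFiniteProofs
import Literature.NumberTheory.GaloisRepresentations.CorNaturality
import Literature.RingTheory.CompleteLocalRings.ChainRingFrobeniusCharacter
import HarnessLib

/-!
# Howard 2004, H.4: the `μ_{p^k}`-valued characters of `R(1)` detect `H²(K_v, R(1))` for EVERY finite level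
# ring — the readout predicate `LocalTwoDetects` without a dualizing family (proofs file)

Topic `NumberTheory/GaloisCohomology/Howard2004` (sequel to `UnramifiedSelfOrthogonalReadout`; THEOREMS ONLY: no
definition, no named fact, no instance, no notation, no `sorry`).

`UnramifiedSelfOrthogonalReadout` defines the readout predicate `D.LocalTwoDetects exp hexp v` — a class
`z ∈ H²(K_v, R(1))` killed by `H²(exp ∘ λ')` for every (`ℤ_p`-semilinear) additive `λ' : R → ℤ/p^k` is zero — and
derives it (`localTwoDetects_of_bijective`) from a DUALIZING FAMILY `(r_i)`, i.e. from an additive isomorphism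
`(R, +) ≅ (ℤ/p^k)^ι` («`H²` commutes with products»).  Such a family exists only when the level ring is additively
FREE over `ℤ/p^k`; the refined levels `R/π^{i+1}` of a ramified DVR are not (cell `pub/bsd-print-x9`, FINDING
«READ-NONFREE», 2026-08-29).  Here the predicate is proved for EVERY finite `R` with `p^k · R = 0`, with no family
and no Frobenius character, from local Tate duality in bidegree `(2, 0)` — the tree's
`ContinuousRep.exists_invariant_cohomologyMap_two_ne_zero` (Serre, *Cohomologie galoisienne*, II §5.2 Thm. 2;
Milne *ADT* I Cor. 2.3: a non-zero `z ∈ H²(K_v, M)`, `M` finite `p^k`-torsion, is detected by an invariant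
`f ∈ Hom_{Γ_{K_v}}(M, μ_{p^k})`) applied to `M = R(1)|_{Γ_{K_v}}`: every such `f`, read back through
`μ_{p^k}(K̄_v) ≅ μ_{p^k}(K̄)` (`muLocalIso`) and `exp : ℤ/p^k ≅ μ_{p^k}`, IS `exp ∘ λ'` for the additive character
`λ' = exp⁻¹ ∘ f`, automatically `ℤ_p`-semilinear (`apply_algebraMap_mul_eq_toZModPow_mul`).

* **`DualityDatum.localTwoDetects_of_finite`** — `[Finite R] → (∀ r, p^k • r = 0) → Bijective exp →
  D.LocalTwoDetects exp hexp (Sum.inr v)` at every finite place `v`.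
* `DualityDatum.eq_zero_of_forall_cohomologyMap_expLam_eq_zero_of_finite` — the same in the applied form
  «`(∀ λ', H²(exp ∘ λ') z = 0) → z = 0`».

Cell `pub/bsd-print-x9`, G87 = Howard 2004 Thm. 1.6.1 (print leaf `stub_h161` of stmt-BirchSwinnertonDyer-22642); seat
`bsd-line-x10b-p1-w6` g9, brick (READ-H2), LEAD g12 ruling 2026-08-29T06:08:59Z.  BSD is not proved by any of this.

References: [Howard2004HeegnerKolyvagin] §1.3 H.4 (arXiv:1202.6340 p. 7 L69–82); [SerreGaloisCohomology1997] II §5.2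
Thm. 2; [MilneADT2006] I Cor. 2.3.
-/

set_option autoImplicit false

noncomputable section

open CategoryTheory Function NumberField IsDedekindDomain Field
open scoped ContRepresentation NumberField

namespace Literature.NumberTheory.GaloisCohomology.Howard2004

open Literature.NumberTheory.GaloisRepresentations
open Literature.NumberTheory.GaloisRepresentations.DiscreteGaloisModule
open Literature.RingTheory.CompleteLocalRings
open _root_.TopRep _root_.ContinuousCohomology

variable {K : Type} [Field K] [NumberField K] {M : Type} [AddCommGroup M] [TopologicalSpace M]
  [DiscreteTopology M] {R : Type} [CommRing R] [Module R M] [TopologicalSpace R] [DiscreteTopology R]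
  {p : ℕ} [Fact p.Prime] [Algebra ℤ_[p] R] {cd : ConjugationDatum K} {ρ : DiscreteGaloisModule K M}
  (D : DualityDatum p cd ρ R) {k : ℕ}
  (exp : ZMod (p ^ k) →+ MuCarrier K (p ^ k))
  (hexp : ∀ (g : absoluteGaloisGroup K) (x : ZMod (p ^ k)),
    exp (cyclotomicCharacterModPow K p k g * x) = mu K (p ^ k) g (exp x))

namespace DualityDatum

/-- **The characters `exp ∘ λ'` of `R(1)` detect `H²(K_v, R(1))` for every FINITE level ring** (`p^k · R = 0`, `exp`
bijective, `v` a finite place): `D.LocalTwoDetects exp hexp (inr v)` — the readout hypothesis `hdet` of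
`isSelfOrthogonalAt_of_unramified`, with NO dualizing family and NO freeness of `(R, +)`.  Proof: by local Tate duality
in bidegree `(2, 0)` (`ContinuousRep.exists_invariant_cohomologyMap_two_ne_zero`) a non-zero `z` is detected by an
invariant `f : R(1)|_{Γ_{K_v}} → μ_{p^k}(K̄_v)`; then `λ' := exp⁻¹ ∘ (μ(K̄) ≅ μ(K̄_v))⁻¹ ∘ f` is an additive
character with `exp ∘ λ' = f` up to `muLocalIso`, so `H²(exp ∘ λ') z = 0` contradicts `H²(ev_f) z ≠ 0`.
[cite: Howard2004HeegnerKolyvagin, §1.3 H.4 (arXiv:1202.6340 p. 7 L78–82: «induced local pairing … → R»)] [cite: SerreGaloisCohomology1997, II §5.2 Thm. 2] [cite: MilneADT2006, Ch. I Cor. 2.3] -/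
theorem localTwoDetects_of_finite [Finite R] (hR : ∀ r : R, p ^ k • r = 0) (hexpb : Bijective exp)
    (v : HeightOneSpectrum (𝓞 K)) : D.LocalTwoDetects exp hexp (Sum.inr v) := by
  classical
  intro z hz
  by_contra hne
  haveI : NeZero (p ^ k) := ⟨pow_ne_zero _ (Fact.out : p.Prime).ne_zero⟩
  -- the local field `K_v = v.adicCompletion K` has characteristic `0`; `Γ_{K_v}` is compact (tree theorems, bound
  -- locally — no instance is declared)
  haveI : CharZero (v.adicCompletion K) := charZero_adicCompletion v
  haveI : CompactSpace (absoluteGaloisGroup (v.adicCompletion K)) := absoluteGaloisGroup_compactSpace _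
  -- local Tate duality in bidegree `(2, 0)` for `R(1)|_{Γ_{K_v}}`
  obtain ⟨f, hf, hfz⟩ := ContinuousRep.exists_invariant_cohomologyMap_two_ne_zero (v.adicCompletion K)
    (p := p) (k := k) (GaloisRep.toLocal v D.twistOne) hR (z := z) hne
  -- the character `λ' = exp⁻¹ ∘ (μ(K̄) ≅ μ(K̄_v))⁻¹ ∘ f`
  let eexp : ZMod (p ^ k) ≃+ MuCarrier K (p ^ k) := AddEquiv.ofBijective exp hexpb
  let eμ : MuCarrier K (p ^ k) ≃+ MuCarrier (v.adicCompletion K) (p ^ k) :=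
    muTransferEquiv K (v.adicCompletion K) (p ^ k)
  let fHom : R →+ MuCarrier (v.adicCompletion K) (p ^ k) :=
    { toFun := fun r => f r
      map_zero' := map_zero f
      map_add' := map_add f }
  let lam' : R →+ ZMod (p ^ k) := eexp.symm.toAddMonoidHom.comp (eμ.symm.toAddMonoidHom.comp fHom)
  have hlam' : ∀ (c : ℤ_[p]) (r : R), lam' (algebraMap ℤ_[p] R c * r) = PadicInt.toZModPow k c * lam' r :=
    apply_algebraMap_mul_eq_toZModPow_mul hR lam'
  have hexp_lam' : ∀ r : R, eμ (exp (lam' r)) = f r := fun r => by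
    change eμ (eexp (eexp.symm (eμ.symm (f r)))) = f r
    rw [AddEquiv.apply_symm_apply, AddEquiv.apply_symm_apply]
  -- `exp ∘ λ'` followed by `μ(K̄) ≅ μ(K̄_v)` IS `ev_f`
  have hcomp : D.expLamLocalHom lam' hlam' exp hexp (Sum.inr v) ≫ (muLocalIso v (p ^ k)).hom =
      ((GaloisRep.toLocal v D.twistOne).evalPairing (mu (v.adicCompletion K) (p ^ k))).flip.leftHom f hf := by
    refine TopRep.hom_ext (ContIntertwiningMap.ext (ContinuousLinearMap.ext fun r => ?_))
    change eμ (exp (lam' r)) = f r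
    exact hexp_lam' r
  -- hence `H²(ev_f) z = (iso) (H²(exp ∘ λ') z) = 0`
  have h1 : cohomologyMap (D.expLamLocalHom lam' hlam' exp hexp (Sum.inr v) ≫ (muLocalIso v (p ^ k)).hom) 2 z =
      cohomologyMap (muLocalIso v (p ^ k)).hom 2
        (cohomologyMap (D.expLamLocalHom lam' hlam' exp hexp (Sum.inr v)) 2 z) :=
    cohomologyMap_comp_apply _ _ 2 z
  have h2 : cohomologyMap (D.expLamLocalHom lam' hlam' exp hexp (Sum.inr v)) 2 z = 0 := hz lam' hlam'
  have h3 : cohomologyMap (muLocalIso v (p ^ k)).hom 2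
      (cohomologyMap (D.expLamLocalHom lam' hlam' exp hexp (Sum.inr v)) 2 z) = 0 :=
    (congrArg (cohomologyMap (muLocalIso v (p ^ k)).hom 2) h2).trans (map_zero _)
  -- (term-mode chaining: the two spellings `Place.Completion (inr v)` / `v.adicCompletion K` of `K_v` agree by `rfl`
  -- but not at `instances` transparency, so `rw` across them is avoided)
  exact hfz (((congrArg (fun φ => cohomologyMap φ 2 z) hcomp).symm.trans h1).trans h3)

/-- **Applied form**: for a finite level ring `R` with `p^k · R = 0` and a bijective trivialisation `exp`, a class
`z ∈ H²(K_v, R(1))` with `H²(exp ∘ λ') z = 0` for every `ℤ_p`-semilinear additive `λ' : R → ℤ/p^k` vanishes — the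
hypothesis-free replacement of `eq_zero_of_forall_cohomologyMap_expLam_lamMul_eq_zero … hbij`.
[cite: Howard2004HeegnerKolyvagin, §1.3 H.4 (arXiv:1202.6340 p. 7 L78–82)] [cite: SerreGaloisCohomology1997, II §5.2 Thm. 2] -/
theorem eq_zero_of_forall_cohomologyMap_expLam_eq_zero_of_finite [Finite R] (hR : ∀ r : R, p ^ k • r = 0)
    (hexpb : Bijective exp) (v : HeightOneSpectrum (𝓞 K)) (z : galoisCohomology (D.twistOne.toLocal (Sum.inr v)) 2)
    (hz : ∀ (lam' : R →+ ZMod (p ^ k))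
      (hlam' : ∀ (c : ℤ_[p]) (r : R), lam' (algebraMap ℤ_[p] R c * r) = PadicInt.toZModPow k c * lam' r),
      cohomologyMap (D.expLamLocalHom lam' hlam' exp hexp (Sum.inr v)) 2 z = 0) :
    z = 0 :=
  D.localTwoDetects_of_finite exp hexp hR hexpb v z hz

end DualityDatum

end Literature.NumberTheory.GaloisCohomology.Howard2004

end
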